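import Mathlib
import HarnessLib
import Literature.Barriers.NavierStokesRegularity.StokesOperatorNotLaplacianFields
import Summits.NavierStokesRegularity.NavierStokesRegularity.Theorems.ThreadingFluxHorizonTowerDipoleTowerMeridional
import Summits.NavierStokesRegularity.NavierStokesRegularity.Theorems.ThreadingFluxHorizonTowerProfileFormulas
import Summits.NavierStokesRegularity.NavierStokesRegularity.Theorems.ThreadingFluxHorizonTowerZonalFrame

/-!
# Crux `PoloidalLiouville` (stmt-NavierStokesRegularity-1222, wall W1), crux idea «horizon-threading-tower» (ns-idea-15):
# DIPOLE TOWERS `{1, m, n}` AT ORDER ONE — helper 5: the two RADIAL ENGINES that exclude the degenerate factor `Q ≡ 0`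

ARM A (ns-exp-scalarLiouville g6), director KEY 2026-08-29T05:03:18Z, bottom-up helper for the third-shell step (S3)/(S3′) of «dipole
towers decided at order one» (route ns-wall-eng-3 g3, TwoShellTowers-RESULTS §4b; plan `pub/ns-exp-scalarLiouville/HANDOFF.md` ADDENDUM 7,
critic remarks r1/r2 of ns-wall-crit-1 g4).  After the product dichotomy (helper 4) the third-shell step must exclude the factor
`Q ≡ 0`; this file proves the two exclusions:

* calculus: `gradient_sub_const_mul_apply`, `gradient_radialWeight_mul` (`∇(g(‖·‖²)H)`),
  the triple-product identities `inner_cross_smul_left_eq`, `inner_cross_right_eq`;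
* `laplacian_mul_rpow_normSq` — `Δ(H·(‖·‖²)^a)(x) = a(4l + 4a + 2)(‖x‖²)^{a−1} H(x)` off the origin for `H` smooth, `l`-homogeneous and
  harmonic (the tree's `divergence_gradient_mul_rpow_normSq`, p665636, read through `div ∇ = Δ`);
* ODD ENGINE ★ `eq_zero_of_meridional_eq_dipoleMultiplier` — a smooth harmonic `C`, homogeneous of ODD degree `n = 2k+1 ≥ 3`, zonal
  about `a ≠ 0`, whose meridional multiplier equals the dipole's, `‖x‖²⟪∇C,a⟫ − ⟪a,x⟫⟪∇C,x⟫ = μ (‖x‖²)^k |a × x|²`, vanishes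
  identically: `G = C − μ⟪a,·⟫(‖·‖²)^k` is zonal with zero meridional derivative, hence `≡ 0` by helper 3
  (`eq_zero_of_zonal_meridional_odd`), so `C = μ⟪a,·⟫(‖·‖²)^k`, and `Δ(⟪a,·⟫(‖·‖²)^k)(a) > 0` (Literature
  `StokesCommutator.laplacian_inner_mul`) forces `μ = 0`;
* EVEN ENGINE ★ `eq_zero_of_radial_combination` — if `α(‖x‖²)^{n/2} B + β(‖x‖²)^{m/2} C = w(‖x‖²)^{(m+n)/2}` off the origin with
  `B ∈ 𝓗_m`, `C ∈ 𝓗_n` smooth harmonic, `m ≠ n`, `m ≥ 2`, `α ≠ 0`, then `B ≡ 0` (apply `Δ` once, eliminate `C`, get `B = w′(‖x‖²)^{m/2}`,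
  apply `Δ` again) — critic remark r2: it is the shell `B` of degree `≥ 2` that carries the contradiction, never the dipole.

HONEST LABEL: helper lemmas toward a special case of a crux-idea conjecture; `HorizonTowerZonality`, `PoloidalLiouville` (1222) and NS
regularity are OPEN / NOT proved; nothing here is an NS statement.  `--supports stmt-NavierStokesRegularity-1222 --as helper`.
-/

-- the summit and its single sub-problem share the name (CONVENTIONS §1)
set_option linter.dupNamespace false

noncomputable section

namespace Summit.NavierStokesRegularity.NavierStokesRegularity.Theorems.PoloidalLiouville.HorizonTower

open Set Function Filter Topology InnerProductSpace
open scoped RealInnerProductSpace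
open Literature.Analysis.FluidPDE
open Literature.Geometry.DiscreteGeometry (inner_fin3 norm_sq_fin3)
open Literature.Barriers.NavierStokesRegularity (StokesCommutator.gradient_inner_mul StokesCommutator.laplacian_inner_mul)

section RadialEngines

/-! ### Calculus -/

/-- `∇(f − μ g)(x) = ∇f(x) − μ ∇g(x)` at a point of differentiability. [folklore] -/
theorem gradient_sub_const_mul_apply {f g : E3 → ℝ} {x : E3} (hf : DifferentiableAt ℝ f x) (hg : DifferentiableAt ℝ g x)
    (μ : ℝ) : gradient (fun y => f y - μ * g y) x = gradient f x - μ • gradient g x := by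
  apply ext_inner_right ℝ
  intro v
  rw [inner_sub_left, real_inner_smul_left, inner_gradient_eq_fderiv, inner_gradient_eq_fderiv, inner_gradient_eq_fderiv,
    fderiv_fun_sub hf (hg.const_mul μ), fderiv_const_mul hg μ]
  rw [_root_.sub_apply, _root_.smul_apply, smul_eq_mul]

/-- `⟪x, (κ a) × g⟫ = −κ ⟪a × x, g⟫`. [folklore] -/
theorem inner_cross_smul_left_eq (κ : ℝ) (a x g : E3) : ⟪x, cross (κ • a) g⟫ = -κ * ⟪cross a x, g⟫ := by
  obtain ⟨p0, p1, p2⟩ := cross_fin3 (κ • a) g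
  obtain ⟨q0, q1, q2⟩ := cross_fin3 a x
  rw [inner_fin3, inner_fin3, p0, p1, p2, q0, q1, q2]
  simp only [PiLp.smul_apply, smul_eq_mul]
  ring

/-- `⟪x, g × a⟫ = ⟪a × x, g⟫` (cyclic triple product). [folklore] -/
theorem inner_cross_right_eq (a x g : E3) : ⟪x, cross g a⟫ = ⟪cross a x, g⟫ := by
  obtain ⟨p0, p1, p2⟩ := cross_fin3 g a
  obtain ⟨q0, q1, q2⟩ := cross_fin3 a x
  rw [inner_fin3, inner_fin3, p0, p1, p2, q0, q1, q2]
  ring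

/-- `∇(g(‖·‖²) H)(x) = g(‖x‖²) ∇H(x) + (2 g′(‖x‖²) H(x)) x` at a point of differentiability of `H`. [folklore] -/
theorem gradient_radialWeight_mul {g : ℝ → ℝ} {g₁ : ℝ} {H : E3 → ℝ} {x : E3} (hg : HasDerivAt g g₁ (‖x‖ ^ 2))
    (hH : DifferentiableAt ℝ H x) :
    gradient (fun y : E3 => g (‖y‖ ^ 2) * H y) x = g (‖x‖ ^ 2) • gradient H x + (H x * (2 * g₁)) • x := by
  have hgd : DifferentiableAt ℝ (fun y : E3 => g (‖y‖ ^ 2)) x := hg.differentiableAt.comp x (differentiableAt_id.norm_sq ℝ)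
  rw [gradient_mul_apply hgd hH, gradient_comp_norm_sq hg, smul_smul]

/-- **`Δ(H·(‖·‖²)^a)(x) = a(4l + 4a + 2)(‖x‖²)^{a−1} H(x)`** off the origin, for `H` smooth, homogeneous of degree `l` and harmonic
(the tree's `divergence_gradient_mul_rpow_normSq` through `div ∇ = Δ`). [folklore] -/
theorem laplacian_mul_rpow_normSq {H : E3 → ℝ} {l : ℕ} {x : E3} (hx : x ≠ 0) (hH : ContDiff ℝ (⊤ : ℕ∞) H)
    (hhom : ∀ (c : ℝ) (y : E3), H (c • y) = c ^ l * H y) (hharm : ∀ y, Laplacian.laplacian H y = 0) (a : ℝ) :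
    Laplacian.laplacian (fun z : E3 => H z * (‖z‖ ^ 2) ^ a) x = a * (4 * l + 4 * a + 2) * (‖x‖ ^ 2) ^ (a - 1) * H x := by
  have h2 : ContDiffAt ℝ 2 (fun z : E3 => H z * (‖z‖ ^ 2) ^ a) x :=
    (hH.contDiffAt.of_le (by norm_cast)).mul (contDiffAt_rpow_normSq hx a)
  rw [← divergence_gradient_eq_laplacian_of_contDiffAt h2]
  exact divergence_gradient_mul_rpow_normSq hx hH hhom hharm a

/-! ### The odd engine -/

/-- Gradient of the model zonal function `F(y) = ⟪a, y⟫ (‖y‖²)^k`: `∇F(x) = (‖x‖²)^k a + 2⟪a,x⟫ k (‖x‖²)^{k−1} x`. [folklore] -/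
theorem gradient_inner_mul_normSq_pow (a x : E3) (k : ℕ) :
    gradient (fun y : E3 => ⟪a, y⟫ * (‖y‖ ^ 2) ^ k) x
      = ((‖x‖ ^ 2) ^ k) • a + (2 * ⟪a, x⟫ * (k * (‖x‖ ^ 2) ^ (k - 1))) • x :=
  StokesCommutator.gradient_inner_mul (P := fun s : ℝ => s ^ k) (P' := fun s : ℝ => (k : ℝ) * s ^ (k - 1))
    (fun s => hasDerivAt_pow k s) a x

/-- The model zonal function of odd degree `2k+1 ≥ 3` is NOT harmonic: `Δ(⟪a,·⟫(‖·‖²)^k)(a) > 0` for `a ≠ 0`, `k ≥ 1`. [folklore] -/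
theorem laplacian_inner_mul_normSq_pow_pos {a : E3} (ha : a ≠ 0) {k : ℕ} (hk : 1 ≤ k) :
    0 < Laplacian.laplacian (fun y : E3 => ⟪a, y⟫ * (‖y‖ ^ 2) ^ k) a := by
  have hP : ∀ s : ℝ, HasDerivAt (fun s : ℝ => s ^ k) ((k : ℝ) * s ^ (k - 1)) s := fun s => hasDerivAt_pow k s
  have hP' : ∀ s : ℝ, HasDerivAt (fun s : ℝ => (k : ℝ) * s ^ (k - 1)) ((k : ℝ) * (((k - 1 : ℕ) : ℝ) * s ^ (k - 1 - 1))) s :=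
    fun s => (hasDerivAt_pow (k - 1) s).const_mul _
  have hPs : ContDiff ℝ 2 (fun s : ℝ => s ^ k) := contDiff_id.pow k
  rw [StokesCommutator.laplacian_inner_mul hP hP' hPs a a]
  have ha2 : 0 < ‖a‖ ^ 2 := by positivity
  have h1 : 0 < ⟪a, a⟫ := by rw [real_inner_self_eq_norm_sq]; exact ha2
  have h2 : 0 ≤ 4 * ((k : ℝ) * ((((k - 1 : ℕ) : ℝ)) * (‖a‖ ^ 2) ^ (k - 1 - 1))) * ‖a‖ ^ 2 := by positivity
  have h3 : 0 < 10 * ((k : ℝ) * (‖a‖ ^ 2) ^ (k - 1)) := by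
    have : (0 : ℝ) < k := by exact_mod_cast hk
    positivity
  exact mul_pos h1 (by linarith)

/-- ★ **ODD ENGINE.**  A smooth harmonic function `C`, homogeneous of odd degree `n = 2k+1 ≥ 3` under all real dilations, zonal about
`a ≠ 0` (`⟪a × x, ∇C(x)⟫ ≡ 0`), whose meridional multiplier equals the dipole's — `‖x‖²⟪∇C(x), a⟫ − ⟪a, x⟫⟪∇C(x), x⟫ = μ (‖x‖²)^k |a × x|²`
for all `x` — vanishes identically. [folklore] -/
theorem eq_zero_of_meridional_eq_dipoleMultiplier {C : E3 → ℝ} {a : E3} {n k : ℕ} {μ : ℝ} (ha : a ≠ 0) (hn : n = 2 * k + 1)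
    (hk : 1 ≤ k) (hC : ContDiff ℝ (⊤ : ℕ∞) C) (hhomC : ∀ (c : ℝ) (y : E3), C (c • y) = c ^ n * C y)
    (hharmC : ∀ y, Laplacian.laplacian C y = 0) (hCz : ∀ x : E3, ⟪cross a x, gradient C x⟫ = 0)
    (hM : ∀ x : E3, ‖x‖ ^ 2 * ⟪gradient C x, a⟫ - ⟪a, x⟫ * ⟪gradient C x, x⟫ = μ * ((‖x‖ ^ 2) ^ k * ‖cross a x‖ ^ 2)) :
    ∀ y : E3, C y = 0 := by
  -- the model zonal function `F`
  set F : E3 → ℝ := fun y => ⟪a, y⟫ * (‖y‖ ^ 2) ^ k with hF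
  have hFs : ContDiff ℝ (⊤ : ℕ∞) F := (contDiff_const.inner ℝ contDiff_id).mul ((contDiff_norm_sq ℝ).pow k)
  have hgradF : ∀ x : E3, gradient F x = ((‖x‖ ^ 2) ^ k) • a + (2 * ⟪a, x⟫ * (k * (‖x‖ ^ 2) ^ (k - 1))) • x :=
    fun x => gradient_inner_mul_normSq_pow a x k
  have hhomF : ∀ (c : ℝ) (y : E3), F (c • y) = c ^ n * F y := by
    intro c y
    simp only [hF, inner_smul_right, norm_smul, Real.norm_eq_abs, mul_pow, sq_abs, hn]
    ring
  -- `G = C − μ F`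
  set G : E3 → ℝ := fun y => C y - μ * F y with hG
  have hCd : Differentiable ℝ C := hC.differentiable (by simp)
  have hFd : Differentiable ℝ F := hFs.differentiable (by simp)
  have hG1 : ContDiff ℝ 1 G := (hC.of_le (by norm_cast)).sub (contDiff_const.mul (hFs.of_le (by norm_cast)))
  have hgradG : ∀ x : E3, gradient G x = gradient C x - μ • gradient F x :=
    fun x => gradient_sub_const_mul_apply (hCd x) (hFd x) μ
  have hGhom : ∀ (c : ℝ) (y : E3), G (c • y) = c ^ n * G y := by
    intro c y; simp only [hG, hhomC, hhomF]; ring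
  -- `a × x ⊥ a, x`; the meridional field `V = ‖x‖² a − ⟪a,x⟫ x`
  have hVa : ∀ x : E3, ⟪a, ‖x‖ ^ 2 • a - ⟪a, x⟫ • x⟫ = ‖cross a x‖ ^ 2 := fun x => by
    rw [inner_sub_right, inner_smul_right, inner_smul_right, real_inner_self_eq_norm_sq, Zonal.norm_cross_sq]; ring
  have hVx : ∀ x : E3, ⟪x, ‖x‖ ^ 2 • a - ⟪a, x⟫ • x⟫ = 0 := fun x => by
    rw [inner_sub_right, inner_smul_right, inner_smul_right, real_inner_self_eq_norm_sq, real_inner_comm]; ring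
  have hGrot : ∀ x : E3, cross a x ≠ 0 → ⟪gradient G x, cross a x⟫ = 0 := by
    intro x _
    rw [hgradG, inner_sub_left, real_inner_smul_left, hgradF, inner_add_left, real_inner_smul_left, real_inner_smul_left,
      real_inner_comm (cross a x) (gradient C x), hCz x, real_inner_comm (cross a x) a, Zonal.inner_cross_self_left,
      real_inner_comm (cross a x) x, Zonal.inner_cross_self_right]
    ring
  have hGmer : ∀ x : E3, cross a x ≠ 0 → ⟪gradient G x, ‖x‖ ^ 2 • a - ⟪a, x⟫ • x⟫ = 0 := by
    intro x _
    have hVC : ⟪gradient C x, ‖x‖ ^ 2 • a - ⟪a, x⟫ • x⟫ = ‖x‖ ^ 2 * ⟪gradient C x, a⟫ - ⟪a, x⟫ * ⟪gradient C x, x⟫ := by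
      rw [inner_sub_right, inner_smul_right, inner_smul_right]
    rw [hgradG, inner_sub_left, hVC, hM x, real_inner_smul_left, hgradF, inner_add_left, real_inner_smul_left,
      real_inner_smul_left, hVa, hVx]
    ring
  -- helper 3: `G ≡ 0`, i.e. `C = μ F`
  have hodd : Odd n := by rw [hn]; exact odd_two_mul_add_one k
  have hG0 : ∀ y, G y = 0 := eq_zero_of_zonal_meridional_odd ha hodd hG1 hGhom hGrot hGmer
  have hCF : C = fun y => μ * F y := funext fun y => by
    have h := hG0 y
    simp only [hG] at h
    linarith
  -- harmonicity at `a` forces `μ = 0`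
  have hΔ : Laplacian.laplacian C a = μ * Laplacian.laplacian F a := by
    have hfun : C = μ • F := by rw [hCF]; rfl
    rw [hfun, laplacian_smul μ (hFs.contDiffAt.of_le (by norm_cast))]
    rfl
  have hpos : 0 < Laplacian.laplacian F a := laplacian_inner_mul_normSq_pow_pos ha hk
  have hμ : μ = 0 := by
    have h0 : μ * Laplacian.laplacian F a = 0 := by rw [← hΔ]; exact hharmC a
    rcases mul_eq_zero.1 h0 with h | h
    · exact h
    · exact absurd h hpos.ne'
  intro y
  rw [hCF]
  simp [hμ]

/-! ### The even engine -/

/-- ★ **EVEN ENGINE (three-term radial uniqueness).**  Let `B ∈ 𝓗_m`, `C ∈ 𝓗_n` be smooth harmonic functions, homogeneous of degrees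
`m ≠ n` under all real dilations, `m ≥ 2`, and suppose that off the origin
`α (‖x‖²)^{n/2} B(x) + β (‖x‖²)^{m/2} C(x) = w (‖x‖²)^{(m+n)/2}` with `α ≠ 0`.  Then `B ≡ 0`.
(Apply `Δ`: the three terms reproduce themselves with the DISTINCT factors `(n/2)(4m+2n+2)`, `(m/2)(4n+2m+2)`, `((m+n)/2)(2m+2n+2)` times
`(‖x‖²)^{−1}`; eliminating `C` gives `B = w′(‖x‖²)^{m/2}`, which is harmonic only if `w′ = 0`.) [folklore] -/
theorem eq_zero_of_radial_combination {m n : ℕ} {B C : E3 → ℝ} {α β w : ℝ} (hm : 2 ≤ m) (hmn : m ≠ n) (hα : α ≠ 0)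
    (hB : ContDiff ℝ (⊤ : ℕ∞) B) (hhomB : ∀ (c : ℝ) (y : E3), B (c • y) = c ^ m * B y)
    (hharmB : ∀ y, Laplacian.laplacian B y = 0)
    (hC : ContDiff ℝ (⊤ : ℕ∞) C) (hhomC : ∀ (c : ℝ) (y : E3), C (c • y) = c ^ n * C y)
    (hharmC : ∀ y, Laplacian.laplacian C y = 0)
    (hrad : ∀ x : E3, x ≠ 0 →
      α * (B x * (‖x‖ ^ 2) ^ ((n : ℝ) / 2)) + β * (C x * (‖x‖ ^ 2) ^ ((m : ℝ) / 2))
        = w * (‖x‖ ^ 2) ^ (((m : ℝ) + n) / 2)) :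
    ∀ x : E3, B x = 0 := by
  -- the scaled shells and the constant shell
  set B' : E3 → ℝ := fun z => α * B z with hB'
  set C' : E3 → ℝ := fun z => β * C z with hC'
  set K : E3 → ℝ := fun _ => w with hK
  have hB's : ContDiff ℝ (⊤ : ℕ∞) B' := contDiff_const.mul hB
  have hC's : ContDiff ℝ (⊤ : ℕ∞) C' := contDiff_const.mul hC
  have hKs : ContDiff ℝ (⊤ : ℕ∞) K := contDiff_const
  have hhomB' : ∀ (c : ℝ) (y : E3), B' (c • y) = c ^ m * B' y := fun c y => by simp only [hB', hhomB]; ring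
  have hhomC' : ∀ (c : ℝ) (y : E3), C' (c • y) = c ^ n * C' y := fun c y => by simp only [hC', hhomC]; ring
  have hhomK : ∀ (c : ℝ) (y : E3), K (c • y) = c ^ 0 * K y := fun c y => by simp [hK]
  have hharmB' : ∀ y, Laplacian.laplacian B' y = 0 := fun y => by
    have hfun : B' = α • B := rfl
    rw [hfun, laplacian_smul α (hB.contDiffAt.of_le (by norm_cast)), hharmB y, smul_zero]
  have hharmC' : ∀ y, Laplacian.laplacian C' y = 0 := fun y => by
    have hfun : C' = β • C := rfl
    rw [hfun, laplacian_smul β (hC.contDiffAt.of_le (by norm_cast)), hharmC y, smul_zero]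
  have hharmK : ∀ y, Laplacian.laplacian K y = 0 := fun y => by
    rw [hK, laplacian_const]; rfl
  -- exponents
  set a : ℝ := (n : ℝ) / 2 with ha
  set b : ℝ := (m : ℝ) / 2 with hb
  have hab : ((m : ℝ) + n) / 2 = a + b := by rw [ha, hb]; ring
  -- (*) in shell form
  have hstar : ∀ x : E3, x ≠ 0 →
      B' x * (‖x‖ ^ 2) ^ a + C' x * (‖x‖ ^ 2) ^ b = K x * (‖x‖ ^ 2) ^ (a + b) := by
    intro x hx
    have h := hrad x hx
    rw [hab] at h
    simp only [hB', hC', hK]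
    linear_combination h
  -- (**) = `Δ` of (*), off the origin
  have hΔ : ∀ x : E3, x ≠ 0 →
      a * (4 * m + 4 * a + 2) * (‖x‖ ^ 2) ^ (a - 1) * B' x + b * (4 * n + 4 * b + 2) * (‖x‖ ^ 2) ^ (b - 1) * C' x
        = (a + b) * (4 * ((0 : ℕ) : ℝ) + 4 * (a + b) + 2) * (‖x‖ ^ 2) ^ (a + b - 1) * K x := by
    intro x hx
    have h1 := laplacian_mul_rpow_normSq hx hB's hhomB' hharmB' a
    have h2 := laplacian_mul_rpow_normSq hx hC's hhomC' hharmC' b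
    have h3 := laplacian_mul_rpow_normSq hx hKs hhomK hharmK (a + b)
    have hf1 : ContDiffAt ℝ 2 (fun z : E3 => B' z * (‖z‖ ^ 2) ^ a) x :=
      (hB's.contDiffAt.of_le (by norm_cast)).mul (contDiffAt_rpow_normSq hx a)
    have hf2 : ContDiffAt ℝ 2 (fun z : E3 => C' z * (‖z‖ ^ 2) ^ b) x :=
      (hC's.contDiffAt.of_le (by norm_cast)).mul (contDiffAt_rpow_normSq hx b)
    have hev : (fun z : E3 => B' z * (‖z‖ ^ 2) ^ a + C' z * (‖z‖ ^ 2) ^ b)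
        =ᶠ[𝓝 x] (fun z : E3 => K z * (‖z‖ ^ 2) ^ (a + b)) := by
      filter_upwards [isOpen_compl_singleton.mem_nhds hx] with z hz
      exact hstar z hz
    have hcongr := (laplacian_congr_nhds hev).self_of_nhds
    have hadd : Laplacian.laplacian (fun z : E3 => B' z * (‖z‖ ^ 2) ^ a + C' z * (‖z‖ ^ 2) ^ b) x
        = Laplacian.laplacian (fun z : E3 => B' z * (‖z‖ ^ 2) ^ a) x
          + Laplacian.laplacian (fun z : E3 => C' z * (‖z‖ ^ 2) ^ b) x :=
      hf1.laplacian_add hf2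
    rw [hadd, h1, h2, h3] at hcongr
    exact hcongr
  -- elimination of `C`: `α (γ₁ − β₁) B(x) = (γ₁ − δ₁) w (‖x‖²)^b` off the origin
  have hgap : b * (4 * n + 4 * b + 2) - a * (4 * m + 4 * a + 2) = ((m : ℝ) - n) * ((m : ℝ) + n + 1) := by
    rw [ha, hb]; ring
  have hne : b * (4 * n + 4 * b + 2) - a * (4 * m + 4 * a + 2) ≠ 0 := by
    rw [hgap]
    refine mul_ne_zero (sub_ne_zero.2 ?_) (by positivity)
    exact_mod_cast hmn
  set w' : ℝ := (b * (4 * n + 4 * b + 2) - (a + b) * (4 * (a + b) + 2)) * w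
      / (α * (b * (4 * n + 4 * b + 2) - a * (4 * m + 4 * a + 2))) with hw'
  have hBrad : ∀ x : E3, x ≠ 0 → B x = w' * (‖x‖ ^ 2) ^ b := by
    intro x hx
    have hρ : 0 < ‖x‖ ^ 2 := by positivity
    have e1 := hstar x hx
    have e2 := hΔ x hx
    simp only [hK, Nat.cast_zero, mul_zero, zero_add] at e1 e2
    -- powers
    have pa : (‖x‖ ^ 2) ^ (a - 1) = (‖x‖ ^ 2) ^ a / ‖x‖ ^ 2 := Real.rpow_sub_one hρ.ne' a
    have pb : (‖x‖ ^ 2) ^ (b - 1) = (‖x‖ ^ 2) ^ b / ‖x‖ ^ 2 := Real.rpow_sub_one hρ.ne' b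
    have pab : (‖x‖ ^ 2) ^ (a + b - 1) = (‖x‖ ^ 2) ^ (a + b) / ‖x‖ ^ 2 := Real.rpow_sub_one hρ.ne' (a + b)
    have padd : (‖x‖ ^ 2) ^ (a + b) = (‖x‖ ^ 2) ^ a * (‖x‖ ^ 2) ^ b := Real.rpow_add hρ a b
    rw [pa, pb, pab] at e2
    -- (**) × ‖x‖²
    have e3 : a * (4 * m + 4 * a + 2) * (‖x‖ ^ 2) ^ a * B' x + b * (4 * n + 4 * b + 2) * (‖x‖ ^ 2) ^ b * C' x
        = (a + b) * (4 * (a + b) + 2) * (‖x‖ ^ 2) ^ (a + b) * w := by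
      field_simp at e2
      linear_combination e2
    -- eliminate `C'`
    have e4 : (b * (4 * n + 4 * b + 2) - a * (4 * m + 4 * a + 2)) * ((‖x‖ ^ 2) ^ a * B' x)
        = (b * (4 * n + 4 * b + 2) - (a + b) * (4 * (a + b) + 2)) * w * (‖x‖ ^ 2) ^ (a + b) := by
      linear_combination (b * (4 * n + 4 * b + 2)) * e1 - e3
    rw [padd] at e4
    have hρa : (‖x‖ ^ 2) ^ a ≠ 0 := (Real.rpow_pos_of_pos hρ a).ne'
    simp only [hB'] at e4
    -- cancel `(‖x‖²)^a`
    have e5 : (‖x‖ ^ 2) ^ a * ((b * (4 * n + 4 * b + 2) - a * (4 * m + 4 * a + 2)) * (α * B x))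
        = (‖x‖ ^ 2) ^ a * ((b * (4 * n + 4 * b + 2) - (a + b) * (4 * (a + b) + 2)) * w * (‖x‖ ^ 2) ^ b) := by
      linear_combination e4
    have e6 := mul_left_cancel₀ hρa e5
    have hD : α * (b * (4 * n + 4 * b + 2) - a * (4 * m + 4 * a + 2)) ≠ 0 := mul_ne_zero hα hne
    rw [hw', div_mul_eq_mul_div, eq_div_iff hD]
    linear_combination e6
  -- `B = w′ (‖·‖²)^b` is harmonic only if `w′ = 0`
  have hb0 : 0 < b := by
    rw [hb]
    have : (2 : ℝ) ≤ m := by exact_mod_cast hm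
    linarith
  have hw'0 : w' = 0 := by
    -- a point off the origin
    obtain ⟨x, hx⟩ : ∃ x : E3, x ≠ 0 := exists_ne 0
    have hρ : 0 < ‖x‖ ^ 2 := by positivity
    set K' : E3 → ℝ := fun _ => w' with hK'd
    have hK's : ContDiff ℝ (⊤ : ℕ∞) K' := contDiff_const
    have hhomK' : ∀ (c : ℝ) (y : E3), K' (c • y) = c ^ 0 * K' y := fun c y => by simp [hK'd]
    have hharmK' : ∀ y, Laplacian.laplacian K' y = 0 := fun y => by rw [hK'd, laplacian_const]; rfl
    have h3 := laplacian_mul_rpow_normSq hx hK's hhomK' hharmK' b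
    have hev : B =ᶠ[𝓝 x] (fun z : E3 => K' z * (‖z‖ ^ 2) ^ b) := by
      filter_upwards [isOpen_compl_singleton.mem_nhds hx] with z hz
      simpa only [hK'd] using hBrad z hz
    have hcongr := (laplacian_congr_nhds hev).self_of_nhds
    rw [hharmB x, h3] at hcongr
    simp only [hK'd, Nat.cast_zero, mul_zero, zero_add] at hcongr
    -- `0 = b (4b+2) ρ^{b-1} w'`
    have hpos : 0 < b * (4 * b + 2) * (‖x‖ ^ 2) ^ (b - 1) := by
      have := Real.rpow_pos_of_pos hρ (b - 1)
      positivity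
    rcases mul_eq_zero.1 hcongr.symm with h | h
    · exact absurd h hpos.ne'
    · exact h
  -- conclusion
  intro x
  by_cases hx : x = 0
  · have h := hhomB 0 0
    rw [zero_smul, zero_pow (by omega), zero_mul] at h
    rw [hx]; exact h
  · rw [hBrad x hx, hw'0, zero_mul]

end RadialEngines

end Summit.NavierStokesRegularity.NavierStokesRegularity.Theorems.PoloidalLiouville.HorizonTower

end
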